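import Summits.QuantumAdvantage.AdviceFreeQNC0.AffBells25Omega
import HarnessLib

/-!
# Theorem B′ chain, part 4: the Euler recurrence (L4), antipodality, support facts and interior points (L7)

Prover seat qn-prover-3 g14 (ask P-25 of planner qn-p1 g25, ROUND-24 §2.10 (b)–(d)).  Over the typed chain
`AffBells25RigidityChain.lean` (= Sketch25L verbatim) and part 1 (`AffBells25Omega.lean`) we prove:

* **`eulerRecurrence : EulerRecurrence`** (L4a): for `S ⊆ P_τ` and a sign vector `δ`,
  `Σ_e ω^{δ_e} F_S(δ^{(e)}) = (τ + Σ_e ω^{δ_e})·F_S(δ)`.  Three lines: `ω^{δ_e}χ_{δ^{(e)}}(y) = ω^{δ_e}χ_δ(y) + [y_e]χ_δ(y)`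
  (as `ω^{2a} = 1 + ω^{a}`), sum over `e` and `y ∈ S`, `#{e : y_e} ≡ τ`.
* **`antipodality : Antipodality`** (L4b): `F_S(−δ) = F_S(δ)²` (Frobenius, `CharTwo.sum_sq`).
* **`supportFacts : SupportFacts`** (L7a): the support of `F_S ∘ signOf` is closed under complement and no outside
  vertex has exactly one neighbour inside (the recurrence at a zero has a single surviving unit term).
* **`interiorPointLemma : InteriorPointLemma`** (L7b): a point with `F_S = ω^{2⟨δ,1⟩}` on its closed neighbourhood
  forces `Z = τ + n₁ω + n₂ω²` in `R`, i.e. `Z` even and `n₁ ≡ τ` (independence of `{1, ω}`).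

WHAT THIS IS NOT: instrument for the (NP₀) rung of crux stmt-QuantumAdvantage-22907 (route DWalkThree); no route item;
separation NOT moved.
-/

namespace Summit.QuantumAdvantage.AdviceFreeQNC0

namespace AffBells25L

open Finset AffBells24 Polynomial

variable {Z : ℕ}

/-! ### (L4a) the Euler recurrence -/

/-- In `ZMod 3`, `a + a = -a`. -/
theorem add_self_eq_neg_zmod3 (a : ZMod 3) : a + a = -a := by
  revert a; decide

/-- The exponent of a flipped character: `⟨δ^{(e)}, y⟩ = ⟨δ, y⟩ + [y_e]·δ_e`. -/
theorem sum_flipAt (e : Fin Z) (δ : Fin Z → ZMod 3) (y : Fin Z → Bool) :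
    (∑ e', if y e' then flipAt e δ e' else 0) = (∑ e', if y e' then δ e' else 0) + (if y e then δ e else 0) := by
  rw [← add_sum_erase univ _ (mem_univ e), ← add_sum_erase univ (fun e' => if y e' then δ e' else 0) (mem_univ e)]
  have hrest : ∑ e' ∈ univ.erase e, (if y e' then flipAt e δ e' else 0) =
      ∑ e' ∈ univ.erase e, (if y e' then δ e' else 0) := by
    refine sum_congr rfl fun e' he' => ?_
    unfold flipAt
    rw [Function.update_of_ne (ne_of_mem_erase he')]
  rw [hrest]
  unfold flipAt
  rw [Function.update_self]
  by_cases hy : y e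
  · rw [if_pos hy, if_pos hy, ← add_self_eq_neg_zmod3]; ring
  · rw [if_neg hy, if_neg hy]; ring

/-- The flipped character: `χ_{δ^{(e)}}(y) = χ_δ(y)·ω^{[y_e]δ_e}`. -/
theorem chi_flipAt (e : Fin Z) (δ : Fin Z → ZMod 3) (y : Fin Z → Bool) :
    chi (flipAt e δ) y = chi δ y * ωpow (if y e then δ e else 0) := by
  unfold chi
  rw [← ωpow_add, sum_flipAt]

/-- The one-line identity behind the recurrence: `ω^{δ_e}χ_{δ^{(e)}}(y) = ω^{δ_e}χ_δ(y) + [y_e]·χ_δ(y)` (`δ_e ≠ 0`). -/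
theorem ωpow_mul_chi_flipAt (e : Fin Z) (δ : Fin Z → ZMod 3) (he : δ e ≠ 0) (y : Fin Z → Bool) :
    ωpow (δ e) * chi (flipAt e δ) y = ωpow (δ e) * chi δ y + (if y e then chi δ y else 0) := by
  rw [chi_flipAt]
  by_cases hy : y e
  · rw [if_pos hy, if_pos hy]
    have hsq : ωpow (δ e) * ωpow (δ e) = 1 + ωpow (δ e) := by
      rw [← ωpow_add, add_self_eq_neg_zmod3, one_add_ωpow he]
    linear_combination (chi δ y) * hsq
  · rw [if_neg hy, if_neg hy, ωpow_zero, mul_one, add_zero]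

/-- On a parity class, `Σ_e [y_e]·χ = τ·χ`. -/
theorem sum_ite_apply_eq {τ : ℕ} {y : Fin Z → Bool} (hy : y ∈ parityClass Z τ) (x : R) :
    (∑ e, if y e then x else 0) = (τ : R) * x := by
  rw [← sum_filter, sum_const, nsmul_eq_mul]
  congr 1
  unfold parityClass at hy
  rw [mem_filter] at hy
  rw [natCast_eq_mod, hy.2, ← natCast_eq_mod]

/-- **(L4a)** EULER RECURRENCE: `Σ_e ω^{δ_e} F_S(δ^{(e)}) = (τ + Σ_e ω^{δ_e})·F_S(δ)` for `S ⊆ P_τ`, `δ` a sign vector. -/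
theorem eulerRecurrence : EulerRecurrence := by
  intro Z τ S hS δ hδ
  calc (∑ e, ωpow (δ e) * FS S (flipAt e δ))
      = ∑ e, ∑ y ∈ S, (ωpow (δ e) * chi δ y + (if y e then chi δ y else 0)) := by
        refine sum_congr rfl fun e _ => ?_
        unfold FS
        rw [mul_sum]
        exact sum_congr rfl fun y _ => ωpow_mul_chi_flipAt e δ (hδ e) y
    _ = (∑ e, ωpow (δ e) * FS S δ) + ∑ e, ∑ y ∈ S, (if y e then chi δ y else 0) := by
        rw [← sum_add_distrib]
        refine sum_congr rfl fun e _ => ?_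
        unfold FS
        rw [sum_add_distrib, mul_sum]
    _ = (∑ e, ωpow (δ e)) * FS S δ + (τ : R) * FS S δ := by
        congr 1
        · rw [sum_mul]
        · rw [sum_comm]
          unfold FS
          rw [mul_sum]
          exact sum_congr rfl fun y hy => sum_ite_apply_eq (hS hy) (chi δ y)
    _ = ((τ : R) + ∑ e, ωpow (δ e)) * FS S δ := by ring

/-! ### (L4b) antipodality -/

/-- `χ_{−δ} = χ_δ²`. -/
theorem chi_neg (δ : Fin Z → ZMod 3) (y : Fin Z → Bool) : chi (-δ) y = chi δ y ^ 2 := by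
  unfold chi
  rw [← ωpow_neg, ← sum_neg_distrib]
  congr 1
  refine sum_congr rfl fun e _ => ?_
  by_cases hy : y e
  · rw [if_pos hy, if_pos hy, Pi.neg_apply]
  · rw [if_neg hy, if_neg hy, neg_zero]

/-- **(L4b)** ANTIPODALITY: `F_S(−δ) = F_S(δ)²` (Frobenius). -/
theorem antipodality : Antipodality := by
  intro Z S δ
  haveI := charP_two
  unfold FS
  rw [CharTwo.sum_sq]
  exact sum_congr rfl fun y _ => chi_neg δ y

/-! ### Sign vectors of Boolean points -/

/-- `signOf y` is a sign vector. -/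
theorem isSign_signOf (y : Fin Z → Bool) : IsSign (signOf y) := by
  intro e
  unfold signOf
  cases y e <;> decide

/-- Complement ↔ negation: `signOf ȳ = −signOf y`. -/
theorem signOf_compl (y : Fin Z → Bool) : signOf (fun e => !y e) = -signOf y := by
  funext e
  unfold signOf
  rw [Pi.neg_apply]
  show (if (!y e) = true then (2 : ZMod 3) else 1) = -(if y e = true then 2 else 1)
  cases y e <;> decide

/-- Neighbour ↔ sign flip: `signOf (y^e) = (signOf y)^{(e)}`. -/
theorem signOf_nbr (e : Fin Z) (y : Fin Z → Bool) : signOf (nbr e y) = flipAt e (signOf y) := by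
  funext e'
  unfold signOf flipAt nbr
  by_cases h : e' = e
  · subst h
    rw [Function.update_self, Function.update_self]
    show (if (!y e') = true then (2 : ZMod 3) else 1) = -(if y e' = true then 2 else 1)
    cases y e' <;> decide
  · rw [Function.update_of_ne h, Function.update_of_ne h]

/-- Membership in the support. -/
theorem mem_suppF_iff (S : Finset (Fin Z → Bool)) (y : Fin Z → Bool) :
    y ∈ suppF S ↔ FS S (signOf y) ≠ 0 := by
  unfold suppF
  rw [mem_filter]
  exact ⟨fun h => h.2, fun h => ⟨mem_univ _, h⟩⟩

/-- Membership in the twisted support. -/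
theorem mem_suppF1_iff (S : Finset (Fin Z → Bool)) (y : Fin Z → Bool) :
    y ∈ suppF1 S ↔ FS S (signOf y) ≠ ωpow (2 * ∑ e, signOf y e) := by
  unfold suppF1
  rw [mem_filter]
  exact ⟨fun h => h.2, fun h => ⟨mem_univ _, h⟩⟩

/-! ### (L7a) support facts -/

/-- The recurrence along the Boolean neighbours of `v`:
`Σ_e ω^{δ_e} F_S(signOf (v^e)) = (τ + Σ_e ω^{δ_e}) F_S(δ)`, `δ = signOf v`. -/
theorem euler_nbr {τ : ℕ} {S : Finset (Fin Z → Bool)} (hS : S ⊆ parityClass Z τ) (v : Fin Z → Bool) :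
    (∑ e, ωpow (signOf v e) * FS S (signOf (nbr e v))) =
      ((τ : R) + ∑ e, ωpow (signOf v e)) * FS S (signOf v) := by
  have h := eulerRecurrence Z τ S hS (signOf v) (isSign_signOf v)
  simp_rw [signOf_nbr]
  exact h

/-- **(L7a)** SUPPORT FACTS: for `S ⊆ P_τ`, `suppF S` is closed under complement, and no vertex outside it has
exactly one neighbour inside. -/
theorem supportFacts : SupportFacts := by
  classical
  intro Z τ S hS
  refine ⟨fun u hu => ?_, fun v hv => ?_⟩
  · -- complement: F(δ) = F(−(−δ)) = F(−δ)², so F(−δ) = 0 would force F(δ) = 0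
    rw [mem_suppF_iff] at hu ⊢
    rw [signOf_compl]
    intro h0
    apply hu
    have := antipodality Z S (-signOf u)
    rw [neg_neg] at this
    rw [this, h0, zero_pow two_ne_zero]
  · -- a zero with exactly one non-zero neighbour contradicts the recurrence (the surviving term is a unit multiple)
    intro h1
    rw [card_eq_one] at h1
    obtain ⟨e₀, he₀⟩ := h1
    have hmem : ∀ e, nbr e v ∈ suppF S ↔ e = e₀ := fun e => by
      rw [← mem_singleton, ← he₀, mem_filter]; exact ⟨fun h => ⟨mem_univ _, h⟩, fun h => h.2⟩
    have hv0 : FS S (signOf v) = 0 := by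
      by_contra h; exact hv ((mem_suppF_iff S v).2 h)
    have h := euler_nbr hS v
    rw [hv0, mul_zero] at h
    rw [sum_eq_single e₀ (fun e _ hne => ?_) (fun h => absurd (mem_univ _) h)] at h
    · have : FS S (signOf (nbr e₀ v)) ≠ 0 := (mem_suppF_iff S _).1 ((hmem e₀).2 rfl)
      exact this (eq_zero_of_ωpow_mul_eq_zero h)
    · have : FS S (signOf (nbr e v)) = 0 := by
        by_contra hne'
        exact hne ((hmem e).1 ((mem_suppF_iff S _).2 hne'))
      rw [this, mul_zero]

/-! ### (L7b) the interior-point lemma -/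

/-- In `ZMod 3`, `3a = 0`, as `a + 2a = 0`. -/
theorem add_two_mul_zmod3 (a : ZMod 3) : a + 2 * a = 0 := by
  revert a; decide

/-- The total sign of a neighbour: `⟨signOf (y^e), 1⟩ = ⟨signOf y, 1⟩ + signOf y e`. -/
theorem sum_signOf_nbr (e : Fin Z) (y : Fin Z → Bool) :
    (∑ e', signOf (nbr e y) e') = (∑ e', signOf y e') + signOf y e := by
  rw [signOf_nbr, ← add_sum_erase univ _ (mem_univ e), ← add_sum_erase univ (signOf y) (mem_univ e)]
  have hrest : ∑ e' ∈ univ.erase e, flipAt e (signOf y) e' = ∑ e' ∈ univ.erase e, signOf y e' := by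
    refine sum_congr rfl fun e' he' => ?_
    unfold flipAt
    rw [Function.update_of_ne (ne_of_mem_erase he')]
  rw [hrest]
  unfold flipAt
  rw [Function.update_self, ← add_self_eq_neg_zmod3]
  ring

/-- `Σ_e ω^{δ_e} = n₂·ω² + n₁·ω` for `δ = signOf y`, `n₁ = #{e : y_e = false}`, `n₂ = #{e : y_e = true}`. -/
theorem sum_ωpow_signOf (y : Fin Z → Bool) :
    (∑ e, ωpow (signOf y e)) =
      ((univ.filter fun e => y e = true).card : R) * ω ^ 2 + ((univ.filter fun e => y e = false).card : R) * ω := by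
  have hterm : ∀ e, ωpow (signOf y e) = if y e = true then ω ^ 2 else ω := by
    intro e
    unfold signOf
    by_cases h : y e = true
    · rw [if_pos h, if_pos h, ωpow_two]
    · rw [if_neg h, if_neg h, ωpow_one]
  simp_rw [hterm]
  rw [sum_ite, sum_const, sum_const, nsmul_eq_mul, nsmul_eq_mul]
  have hB : (univ.filter fun e => ¬ y e = true) = univ.filter fun e => y e = false := by
    ext e
    simp only [mem_filter, mem_univ, true_and]
    cases y e <;> simp
  rw [hB]

/-- `n₁ + n₂ = Z`. -/
theorem card_true_add_card_false (y : Fin Z → Bool) :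
    (univ.filter fun e => y e = true).card + (univ.filter fun e => y e = false).card = Z := by
  have h := Finset.card_filter_add_card_filter_not (s := (univ : Finset (Fin Z))) (fun e => y e = true)
  rw [card_univ, Fintype.card_fin] at h
  have e2 : (univ.filter fun e => ¬ y e = true) = univ.filter fun e => y e = false := by
    ext e; simp
  rw [e2] at h
  exact h

/-- **(L7b)** INTERIOR-POINT LEMMA: for `S ⊆ P_τ`, a point outside `suppF1 S` all of whose neighbours are outside
has `Z` even and `#{e : y_e = false} ≡ τ (mod 2)`. -/
theorem interiorPointLemma : InteriorPointLemma := by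
  classical
  intro Z τ S hS y hy hnbr
  -- values of F on the closed neighbourhood
  have hFy : FS S (signOf y) = ωpow (2 * ∑ e, signOf y e) := by
    by_contra h; exact hy ((mem_suppF1_iff S y).2 h)
  have hFn : ∀ e, FS S (signOf (nbr e y)) = ωpow (2 * ∑ e', signOf y e') * ωpow (2 * signOf y e) := by
    intro e
    have h : FS S (signOf (nbr e y)) = ωpow (2 * ∑ e', signOf (nbr e y) e') := by
      by_contra h; exact hnbr e ((mem_suppF1_iff S _).2 h)
    rw [h, sum_signOf_nbr, mul_add, ωpow_add]
  -- the recurrence there: Z·Π̄ = (τ + Σ ω^{δ_e})·Π̄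
  have hrec := euler_nbr hS y
  simp_rw [hFn, hFy] at hrec
  have hlhs : (∑ e, ωpow (signOf y e) * (ωpow (2 * ∑ e', signOf y e') * ωpow (2 * signOf y e))) =
      (Z : R) * ωpow (2 * ∑ e', signOf y e') := by
    have : ∀ e, ωpow (signOf y e) * (ωpow (2 * ∑ e', signOf y e') * ωpow (2 * signOf y e)) =
        ωpow (2 * ∑ e', signOf y e') := by
      intro e
      rw [mul_left_comm, ← ωpow_add, add_two_mul_zmod3, ωpow_zero, mul_one]
    simp_rw [this]
    rw [sum_const, card_univ, Fintype.card_fin, nsmul_eq_mul]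
  rw [hlhs] at hrec
  -- cancel the unit Π̄
  have hZ : (Z : R) = (τ : R) + ∑ e, ωpow (signOf y e) := by
    have h := congrArg (fun x => x * ωpow (-(2 * ∑ e', signOf y e'))) hrec
    simp only [mul_assoc, ωpow_mul_neg, mul_one] at h
    exact h
  -- read it in the basis {1, ω}
  rw [sum_ωpow_signOf, omega_eq_F4, F4.omega_sq, ← omega_eq_F4] at hZ
  set n₂ := (univ.filter fun e => y e = true).card with hn₂
  set n₁ := (univ.filter fun e => y e = false).card with hn₁
  have hsum : n₂ + n₁ = Z := card_true_add_card_false y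
  have hkey : ((Z + τ + n₂ : ℕ) : R) + ((n₂ + n₁ : ℕ) : R) * ω = 0 := by
    push_cast
    have h2 := F4.add_self ((τ : R) + (n₂ : R) + ((n₂ : R) + (n₁ : R)) * ω)
    linear_combination hZ + h2
  obtain ⟨h1, h2⟩ := even_of_natCast_add_natCast_mul_omega hkey
  constructor <;> omega

end AffBells25L

end Summit.QuantumAdvantage.AdviceFreeQNC0
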